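import Summits.QuantumFields.QCD.Theses.HeatSlicedQuarks

/-!
# Stub `stub_duhamelEntrywise` of line `Sketch`
(crux `Summit.QuantumFields.QCD.Theses.HeatSlicedQuarks.InterleavedHeatSliceFlow`, item stmt-QuantumFields-8891)

**Duhamel's formula, entrywise** (card transported-parametrix-counterterms; the first input of
`stub_parametrixDiagonal`, which compares the heat semigroup of `H_U = D_W(U)ᴴ D_W(U)` with the
free one).  For arbitrary complex square matrices `A`, `B` over a finite index type and every real
`t`,

  `e^{-tA} - e^{-tB} = -∫₀ᵗ e^{-(t-s)A} (A - B) e^{-sB} ds`,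

stated for each entry `(p, q)` (so that the interval integral is `ℂ`-valued).

Proof.  The interpolation `F(s) = exp((s - t) • A) * exp(s • (-B))` (real scalar multiples) has
`F 0 = e^{-tA}`, `F t = e^{-tB}` and, by the product rule and the derivative of the exponential
along a real ray (`hasDerivAt_exp_smul_const`, taken in the `L^∞` operator normed algebra structure
`Matrix.Norms.Operator`; the exponential itself does not depend on the norm),

  `F'(s) = exp((s - t) • A) A exp(s • (-B)) + exp((s - t) • A) (-B) exp(s • (-B))
         = exp((s - t) • A) (A - B) exp(s • (-B))`.

Passing to the `(p, q)` entry and applying the fundamental theorem of calculus to the scalar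
function `s ↦ F(s) p q` gives `∫₀ᵗ F'(s) p q ds = F(t) p q - F(0) p q`, which is the claim after
identifying the complex scalar multiples `(-(t - s : ℂ)) • A = (s - t) • A` and
`(-(s : ℂ)) • B = s • (-B)` with real ones.  No named facts are used (Mathlib only).
-/

namespace Summit.QuantumFields.QCD.Cruxes.InterleavedHeatSliceFlow.Sketch

open Matrix MeasureTheory intervalIntegral
open scoped Matrix

/-- The Duhamel interpolation `F(s) = exp((s - t) • A) * exp(s • (-B))` has derivative
`F'(s) = exp((s - t) • A) * (A - B) * exp(s • (-B))` (product rule; the derivative of the matrix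
exponential along a real ray is taken in the `L^∞` operator normed algebra structure
`Matrix.Norms.Operator`, whose topology is the product one). -/
private theorem duhamelEntrywise_hasDerivAt {ι : Type*} [Fintype ι] [DecidableEq ι]
    (A B : Matrix ι ι ℂ) (t s : ℝ) :
    HasDerivAt (fun s : ℝ => NormedSpace.exp ((s - t) • A) * NormedSpace.exp (s • (-B)))
      (NormedSpace.exp ((s - t) • A) * (A - B) * NormedSpace.exp (s • (-B))) s := by
  open scoped Matrix.Norms.Operator in
  exact (((hasDerivAt_exp_smul_const (𝕂 := ℝ) A (s - t)).comp_sub_const s t).fun_mul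
    (hasDerivAt_exp_smul_const' (𝕂 := ℝ) (-B) s)).congr_deriv (by noncomm_ring)

/-- The derivative `s ↦ exp((s - t) • A) * (A - B) * exp(s • (-B))` of the Duhamel interpolation
is continuous (for the product topology on matrices). -/
private theorem duhamelEntrywise_continuous {ι : Type*} [Fintype ι] [DecidableEq ι]
    (A B : Matrix ι ι ℂ) (t : ℝ) :
    Continuous fun s : ℝ =>
      NormedSpace.exp ((s - t) • A) * (A - B) * NormedSpace.exp (s • (-B)) := by
  open scoped Matrix.Norms.Operator in
  exact ((NormedSpace.exp_continuous.comp ((continuous_sub_right t).smul continuous_const)).mul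
    continuous_const).mul (NormedSpace.exp_continuous.comp (continuous_id.smul continuous_const))

/-- Duhamel's formula with real scalar multiples, entrywise: the fundamental theorem of calculus
for the scalar function `s ↦ (exp((s - t) • A) * exp(s • (-B))) p q` between `s = 0` and
`s = t`. -/
private theorem duhamelEntrywise_real {ι : Type*} [Fintype ι] [DecidableEq ι]
    (A B : Matrix ι ι ℂ) (t : ℝ) (p q : ι) :
    (NormedSpace.exp ((-t) • A) - NormedSpace.exp (t • (-B))) p q =
      -∫ s in (0 : ℝ)..t,
        (NormedSpace.exp ((s - t) • A) * (A - B) * NormedSpace.exp (s • (-B))) p q := by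
  have hderiv : ∀ s : ℝ,
      HasDerivAt (fun s : ℝ => (NormedSpace.exp ((s - t) • A) * NormedSpace.exp (s • (-B))) p q)
        ((NormedSpace.exp ((s - t) • A) * (A - B) * NormedSpace.exp (s • (-B))) p q) s :=
    fun s => hasDerivAt_pi.1 (hasDerivAt_pi.1 (duhamelEntrywise_hasDerivAt A B t s) p) q
  have hint : IntervalIntegrable (fun s : ℝ =>
      (NormedSpace.exp ((s - t) • A) * (A - B) * NormedSpace.exp (s • (-B))) p q) volume 0 t :=
    ((duhamelEntrywise_continuous A B t).matrix_elem p q).intervalIntegrable 0 t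
  rw [intervalIntegral.integral_eq_sub_of_hasDerivAt (fun s _ => hderiv s) hint]
  simp only [sub_self, zero_smul, NormedSpace.exp_zero, one_mul, mul_one, zero_sub,
    Matrix.sub_apply, neg_sub]

/-- **Duhamel's formula, entrywise** (registered stub `stub_duhamelEntrywise` of line `Sketch`;
card transported-parametrix-counterterms, the first input of `stub_parametrixDiagonal`): for
complex square matrices `A`, `B` over a finite index type, every real `t` and every entry `(p, q)`,

  `(e^{-tA} - e^{-tB}) p q = -∫₀ᵗ (e^{-(t-s)A} (A - B) e^{-sB}) p q ds`.

Product rule for `F(s) = e^{-(t-s)A} e^{-sB}` (`F' = e^{-(t-s)A} (A - B) e^{-sB}`, `F 0 = e^{-tA}`,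
`F t = e^{-tB}`) and the fundamental theorem of calculus for the entry `s ↦ F(s) p q`. -/
theorem stub_duhamelEntrywise :
    ∀ (ι : Type) [Fintype ι] [DecidableEq ι] (A B : Matrix ι ι ℂ) (t : ℝ) (p q : ι),
      (NormedSpace.exp (-(t : ℂ) • A) - NormedSpace.exp (-(t : ℂ) • B)) p q =
        -∫ s in (0 : ℝ)..t, (NormedSpace.exp (-((t - s : ℝ) : ℂ) • A) * (A - B) *
          NormedSpace.exp (-(s : ℂ) • B)) p q := by
  intro ι _ _ A B t p q
  -- the complex scalar multiples are real ones: `(-(t - s : ℂ)) • A = (s - t) • A`, ...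
  have hA : ∀ s : ℝ, NormedSpace.exp (-((t - s : ℝ) : ℂ) • A) = NormedSpace.exp ((s - t) • A) :=
    fun s => by
    congr 1
    ext i j
    simp [Matrix.smul_apply, Complex.real_smul]
  have hB : ∀ s : ℝ, NormedSpace.exp (-(s : ℂ) • B) = NormedSpace.exp (s • (-B)) := fun s => by
    congr 1
    ext i j
    simp [Matrix.smul_apply, Complex.real_smul]
  have hA₀ : NormedSpace.exp (-(t : ℂ) • A) = NormedSpace.exp ((-t) • A) := by
    congr 1
    ext i j
    simp [Matrix.smul_apply, Complex.real_smul]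
  simp_rw [hA, hB]
  rw [hA₀]
  exact duhamelEntrywise_real A B t p q

end Summit.QuantumFields.QCD.Cruxes.InterleavedHeatSliceFlow.Sketch
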